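import Summits.ValiantsHypothesis.ValiantsHypothesis.Theses.BarrierLever

/-!
# Route BarrierLever — `ChainCertificatesExist → ChainCertificatesExistOnIrreducibleLayouts`

Support file for item stmt-ValiantsHypothesis-19658 (`ChainCertificatesExistOnIrreducibleLayouts`,
cell valiant-natproofs, rung V4, 𝒟-side of door (c); prover seat val-np-p7 g0).

The item is the specialisation of the conjecture `ChainCertificatesExist` (stmt-19652) to
dimension `h + 1` with two extra hypotheses (no R1 literal-pair split, no R2 twin-free pair)
that the conclusion does not use; this file records the implication so that a proof of 19652
closes 19658 mechanically.

Remark (seat memo `HOME/val-np-p7/MEMO-19658-g0.md`): the converse direction is nearly as strong —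
the certificate only sees the reduced layout `(U ∖ W, W ∖ U)`, irreducibility forces exactly
`#{i : a ∈ u_i} ≠ #{j : a ∈ w_j}` for every coordinate `a` on it (condition N1), and every
common-free N1 layout, padded and dressed with common points, is the reduced layout of an
irreducible one; so 19658 is equivalent to «chain certificates for all common-free N1 layouts».

WHAT THIS IS NOT: no certificate is constructed here; 19652 and 19658 remain conjectures
(census: kit j259994); nothing on UT-D (19316), TT (19152), item 19717, crux 14610 or VP ≠ VNP.
-/

-- layout Summits/ValiantsHypothesis/ValiantsHypothesis forces the duplicated namespace component
set_option linter.dupNamespace false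

namespace Summit.ValiantsHypothesis.ValiantsHypothesis.Theorems.BarrierLever.ChainIrred

open Summit.ValiantsHypothesis.ValiantsHypothesis.Theses.BarrierLever

/-- `ChainCertificatesExist` (stmt-19652) implies `ChainCertificatesExistOnIrreducibleLayouts`
(stmt-19658): specialise to dimension `h + 1` and discard the irreducibility hypotheses. -/
theorem chainCertificatesExistOnIrreducibleLayouts_of_exist
    (H : ChainCertificatesExist) : ChainCertificatesExistOnIrreducibleLayouts := by
  intro h r u w hu hw _ _
  exact H (h + 1) r u w hu hw

end Summit.ValiantsHypothesis.ValiantsHypothesis.Theorems.BarrierLever.ChainIrred
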